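import Summits.ValiantsHypothesis.ValiantsHypothesis.Theorems.GrenetZeonTwoDimCoefficientsDefs

/-!
# `GrenetZeon.DualUnipotentThreeHalves` (stmt-ValiantsHypothesis-24318) — line «flag_cost», S3a: the RUN BOUND
# «flag-cheap ⇒ slow plane» (potential bookkeeping on a flag), PROVED

Port (val-lit desk g12 RULING #272 (c); porter val-port-1; text = val-idea-9 g3's, credited) of §1/§3 of the crux workfile
`Cruxes/DualUnipotentThreeHalves/Lines/flag_cost.lean` (val-idea-9 g3, negation lens; val-idea-crit-3 VERDICT #20 =
PASS-WITH-PRICE, STRUCTURE tier: «S3 split S3a ∧ S3b with S3a PROVED in Lean; residual S3b `FlagCostLaw` typed LAW, 0 provers»).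
The workfile's definitions `lineSubst`, `flagDeg`, `FlagAdapted`, `FlagAdaptedUpTo`, `FlagCheap`, `RunBound` are UNFOLDED
verbatim in the statements below (crux workfiles are not importable from `Theorems/`), so that the line can take
`runBound_proof := …FlagCost.runBound` by `exact` (δ-unfolding).  `AffMat n m = Matrix (Fin m) (Fin m) (ℂ[x_{ij}])` is the
tree's `…GrenetZeonTwoDimCoefficientsDefs` (`DimTwoCases.AffMat`, `DimTwoCases.IsAffine`).

THE LEVER (a potential on a flag).  Fix levels `lvl : Fin m → ℕ` with `lvl < p`, a drop `r` and a climb weight `a+1`.  A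
matrix `M(s)` of one-variable polynomials is ADAPTED if the `s^e`-part of its `(i,j)` entry is nonzero only when
`(a+1)·e + lvl j ≤ lvl i + r`.  Along every path the bookkeeping gives `coeff_{s^e} (M^L)_{ij} ≠ 0 ⇒ (a+1)·e + lvl j ≤
lvl i + r·L` (`coeff_pow_of_flagAdapted`, induction on `L`), hence every entry of `M^{n-1}` has `s`-degree
`≤ flagDeg p r a n := ⌊(p-1+r(n-1))/(a+1)⌋` (`totalDegree_pow_le_flagDeg`), and the bound is invariant under a constant
change of basis (`conj_pow_eq`, `totalDegree_conj_le`).  Consequently: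

* `runBound` — **S3a (RUN BOUND)**: if the pencil `N` is FLAG-CHEAP (some direction space `K` and order `k` with
  `(k+1)·n < dim K` such that along every line `x + s v`, `v ∈ K`, the substituted pencil is — after a constant change of
  basis that may depend on the line — adapted to SOME flag with `flagDeg ≤ k`), then `K, k` is a SLOW PLANE for `N`:
  every entry of `N(x + s v)^{n-1}` has `s`-degree `≤ k` and `(k+1)·n < dim K`.
* `slowPlane_of_runBound_flagCostLaw` — the line's composition S3a + S3b ⇒ S3 with S3b (`FlagCostLaw`) and S3
  (`SlowPlane`) unfolded, as a conditional (S3b is the line's OPEN law; nothing is asserted about it).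

Honest framing.  Helper lemmas (`--supports stmt-ValiantsHypothesis-24318 --as helper`): S3a is per-agnostic bookkeeping;
S3b `FlagCostLaw`, S3 `SlowPlane`, S2 `GMSBound` (= the typed-open fact `Literature.LinearAlgebra.
GutermanMeshulamSpiridonov2023_cor_1_6`), the crux `DualUnipotentThreeHalves`, rung 8062 and `VP ≠ VNP` are untouched /
NOT proved.  No definitions, no named facts.  [folklore] (filtration / degree count on a flag).
-/

-- `Summit.ValiantsHypothesis.ValiantsHypothesis.…` repeats a component by the D-0017 layout
-- (single-conjunct summit), which the `dupNamespace` linter flags; the name is mandated.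
set_option linter.dupNamespace false

noncomputable section

namespace Summit.ValiantsHypothesis.ValiantsHypothesis.Theorems.GrenetZeon.FlagCost

open MvPolynomial Matrix
open scoped BigOperators
open Summit.ValiantsHypothesis.ValiantsHypothesis.Cruxes.TwoDimCoefficients.DimTwoCases (AffMat IsAffine)

/-! ## §1 Potential bookkeeping along paths -/

/-- The potential bookkeeping along paths: adaptedness (`coeff d (M i j) ≠ 0 → (a+1)·d 0 + lvl j ≤ lvl i + r`, the line's
`FlagAdapted lvl r a M` unfolded) propagates to every power with drop `r·L`. [folklore] -/
theorem coeff_pow_of_flagAdapted {m : ℕ} (lvl : Fin m → ℕ) (r a : ℕ)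
    (M : Matrix (Fin m) (Fin m) (MvPolynomial (Fin 1) ℂ))
    (h : ∀ (i j : Fin m) (d : Fin 1 →₀ ℕ), coeff d (M i j) ≠ 0 → (a + 1) * d 0 + lvl j ≤ lvl i + r) :
    ∀ (L : ℕ) (i j : Fin m) (d : Fin 1 →₀ ℕ),
      coeff d ((M ^ L) i j) ≠ 0 → (a + 1) * d 0 + lvl j ≤ lvl i + r * L := by
  intro L
  induction L with
  | zero =>
    intro i j d hd
    rw [pow_zero] at hd
    by_cases hij : i = j
    · subst hij
      rw [Matrix.one_apply_eq, coeff_one] at hd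
      by_cases h0 : (0 : Fin 1 →₀ ℕ) = d
      · subst h0
        simp
      · rw [if_neg h0] at hd
        exact absurd rfl hd
    · rw [Matrix.one_apply_ne hij, coeff_zero] at hd
      exact absurd rfl hd
  | succ L ih =>
    intro i j d hd
    rw [pow_succ, Matrix.mul_apply, coeff_sum] at hd
    obtain ⟨t, -, ht⟩ := Finset.exists_ne_zero_of_sum_ne_zero hd
    rw [coeff_mul] at ht
    obtain ⟨q, hq, hne⟩ := Finset.exists_ne_zero_of_sum_ne_zero ht
    rw [Finset.HasAntidiagonal.mem_antidiagonal] at hq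
    have h1 : coeff q.1 ((M ^ L) i t) ≠ 0 := left_ne_zero_of_mul hne
    have h2 : coeff q.2 (M t j) ≠ 0 := right_ne_zero_of_mul hne
    have e1 := ih i t q.1 h1
    have e2 := h t j q.2 h2
    have hsum : d 0 = q.1 0 + q.2 0 := by
      rw [← hq, Finsupp.add_apply]
    have key : (a + 1) * d 0 = (a + 1) * q.1 0 + (a + 1) * q.2 0 := by rw [hsum, mul_add]
    have hrL : r * (L + 1) = r * L + r := by rw [mul_add, mul_one]
    rw [key, hrL]
    generalize (a + 1) * q.1 0 = A1 at e1 ⊢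
    generalize (a + 1) * q.2 0 = A2 at e2 ⊢
    generalize r * L = RL at e1 ⊢
    omega

/-- Degree budget: an adapted matrix with levels `< p` has `(n-1)`-st power of `s`-degree `≤ ⌊(p-1+r(n-1))/(a+1)⌋` (the
line's `flagDeg p r a n`, unfolded). [folklore] -/
theorem totalDegree_pow_le_flagDeg {m : ℕ} (lvl : Fin m → ℕ) (p r a n : ℕ) (hl : ∀ i, lvl i < p)
    (M : Matrix (Fin m) (Fin m) (MvPolynomial (Fin 1) ℂ))
    (h : ∀ (i j : Fin m) (d : Fin 1 →₀ ℕ), coeff d (M i j) ≠ 0 → (a + 1) * d 0 + lvl j ≤ lvl i + r) (i j : Fin m) :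
    ((M ^ (n - 1)) i j).totalDegree ≤ (p - 1 + r * (n - 1)) / (a + 1) := by
  rw [totalDegree]
  refine Finset.sup_le fun d hd => ?_
  have hne : coeff d ((M ^ (n - 1)) i j) ≠ 0 := mem_support_iff.mp hd
  have e := coeff_pow_of_flagAdapted lvl r a M h (n - 1) i j d hne
  have hsum : (d.sum fun _ e => e) = d 0 := by
    rw [Finsupp.sum_fintype _ _ (fun _ => rfl)]
    simp
  rw [hsum]
  rw [Nat.le_div_iff_mul_le (Nat.succ_pos a), mul_comm]
  have hi := hl i
  generalize (a + 1) * d 0 = A at e ⊢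
  generalize r * (n - 1) = B at e ⊢
  omega

/-- Powers of a conjugate: `G' (G X G')^L G = X^L` as soon as `G' G = 1`. [folklore] -/
theorem conj_pow_eq {m : ℕ} {R : Type*} [Semiring R] (G G' X : Matrix (Fin m) (Fin m) R) (hGG : G' * G = 1) :
    ∀ L : ℕ, G' * (G * X * G') ^ L * G = X ^ L := by
  intro L
  induction L with
  | zero => rw [pow_zero, pow_zero, Matrix.mul_one, hGG]
  | succ L ih =>
    calc G' * (G * X * G') ^ (L + 1) * G
        = (G' * (G * X * G') ^ L * G) * X * (G' * G) := by
          rw [pow_succ]; simp only [Matrix.mul_assoc]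
      _ = X ^ (L + 1) := by rw [ih, hGG, Matrix.mul_one, pow_succ]

/-- Entry degrees are invariant under a constant change of basis. [folklore] -/
theorem totalDegree_conj_le {m k : ℕ} (G G' : Matrix (Fin m) (Fin m) ℂ)
    (X : Matrix (Fin m) (Fin m) (MvPolynomial (Fin 1) ℂ)) (hX : ∀ a b, (X a b).totalDegree ≤ k) (i j : Fin m) :
    ((G'.map C * X * G.map C : Matrix (Fin m) (Fin m) (MvPolynomial (Fin 1) ℂ)) i j).totalDegree ≤ k := by
  simp only [Matrix.mul_apply, Matrix.map_apply]
  refine (totalDegree_finsetSum _ _).trans (Finset.sup_le fun b _ => ?_)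
  refine (totalDegree_mul _ _).trans ?_
  rw [totalDegree_C, add_zero]
  refine (totalDegree_finsetSum _ _).trans (Finset.sup_le fun c _ => ?_)
  refine (totalDegree_mul _ _).trans ?_
  rw [totalDegree_C, zero_add]
  exact hX c b

/-! ## §2 S3a: the run bound -/

/-- **S3a — RUN BOUND** (`flag_cost :: runBound_proof`, statement = the line's `RunBound` with `FlagCheap`, `FlagAdaptedUpTo`,
`FlagAdapted`, `flagDeg`, `lineSubst` unfolded verbatim): a flag-cheap pencil has a slow plane — the same `K, k`.
Credit: val-idea-9 g3 (workfile proof); port by name. [folklore] -/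
theorem runBound (n m : ℕ) (N : AffMat n m)
    (hN : ∃ (K : Submodule ℂ (Fin n × Fin n → ℂ)) (k : ℕ),
      (∀ x v : Fin n × Fin n → ℂ, v ∈ K →
        ∃ (g : (Matrix (Fin m) (Fin m) ℂ)ˣ) (lvl : Fin m → ℕ) (p r a : ℕ),
          (∀ i, lvl i < p) ∧ (p - 1 + r * (n - 1)) / (a + 1) ≤ k ∧
          (∀ (i j : Fin m) (d : Fin 1 →₀ ℕ),
            coeff d (((g : Matrix (Fin m) (Fin m) ℂ).map C
                * N.map (aeval fun c => (C (x c) + ∑ t : Fin 1, C (v c) * X t : MvPolynomial (Fin 1) ℂ))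
                * (↑g⁻¹ : Matrix (Fin m) (Fin m) ℂ).map C : Matrix (Fin m) (Fin m) (MvPolynomial (Fin 1) ℂ)) i j) ≠ 0 →
              (a + 1) * d 0 + lvl j ≤ lvl i + r)) ∧
      (k + 1) * n < Module.finrank ℂ K) :
    ∃ (K : Submodule ℂ (Fin n × Fin n → ℂ)) (k : ℕ),
      (∀ x v : Fin n × Fin n → ℂ, v ∈ K → ∀ i j : Fin m,
        (((N.map (aeval fun c => (C (x c) + ∑ t : Fin 1, C (v c) * X t : MvPolynomial (Fin 1) ℂ))) ^ (n - 1)) i j).totalDegree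
          ≤ k) ∧
      (k + 1) * n < Module.finrank ℂ K := by
  obtain ⟨K, k, hadapt, hdim⟩ := hN
  refine ⟨K, k, ?_, hdim⟩
  intro x v hv i j
  obtain ⟨g, lvl, p, r, a, hl, hk, hA⟩ := hadapt x v hv
  set N' := N.map (aeval fun c => (C (x c) + ∑ t : Fin 1, C (v c) * X t : MvPolynomial (Fin 1) ℂ)) with hN'
  set G : Matrix (Fin m) (Fin m) (MvPolynomial (Fin 1) ℂ) := (g : Matrix (Fin m) (Fin m) ℂ).map C with hG
  set G' : Matrix (Fin m) (Fin m) (MvPolynomial (Fin 1) ℂ) := (↑g⁻¹ : Matrix (Fin m) (Fin m) ℂ).map C with hG'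
  have hGG : G' * G = 1 := by
    rw [hG, hG', ← Matrix.map_mul, Units.inv_mul, Matrix.map_one _ C_0 C_1]
  have hdegA : ∀ a' b', (((G * N' * G') ^ (n - 1)) a' b').totalDegree ≤ k := fun a' b' =>
    (totalDegree_pow_le_flagDeg lvl p r a n hl _ hA a' b').trans hk
  have hconj : N' ^ (n - 1) = G' * (G * N' * G') ^ (n - 1) * G := (conj_pow_eq G G' N' hGG (n - 1)).symm
  rw [hconj]
  exact totalDegree_conj_le (g : Matrix (Fin m) (Fin m) ℂ) (↑g⁻¹ : Matrix (Fin m) (Fin m) ℂ)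
    ((G * N' * G') ^ (n - 1)) hdegA i j

/-- **S3a + S3b ⇒ S3** (`flag_cost :: slowPlane_of_flagCost`, with `FlagCostLaw` (S3b, the line's OPEN law — a HYPOTHESIS
here, never asserted) and `SlowPlane` (S3) unfolded; `IsAffine` is the tree's): if every affine nilpotent pencil in the window
`C₀·m² < n³` is flag-cheap, then every such pencil has a slow plane. [folklore] -/
theorem slowPlane_of_runBound_flagCostLaw
    (hb : ∃ C₀ n₀ : ℕ, ∀ n ≥ n₀, ∀ m : ℕ, C₀ * m ^ 2 < n ^ 3 → ∀ N : AffMat n m,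
      IsAffine N → N ^ m = 0 →
      ∃ (K : Submodule ℂ (Fin n × Fin n → ℂ)) (k : ℕ),
        (∀ x v : Fin n × Fin n → ℂ, v ∈ K →
          ∃ (g : (Matrix (Fin m) (Fin m) ℂ)ˣ) (lvl : Fin m → ℕ) (p r a : ℕ),
            (∀ i, lvl i < p) ∧ (p - 1 + r * (n - 1)) / (a + 1) ≤ k ∧
            (∀ (i j : Fin m) (d : Fin 1 →₀ ℕ),
              coeff d (((g : Matrix (Fin m) (Fin m) ℂ).map C
                  * N.map (aeval fun c => (C (x c) + ∑ t : Fin 1, C (v c) * X t : MvPolynomial (Fin 1) ℂ))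
                  * (↑g⁻¹ : Matrix (Fin m) (Fin m) ℂ).map C : Matrix (Fin m) (Fin m) (MvPolynomial (Fin 1) ℂ)) i j) ≠ 0 →
                (a + 1) * d 0 + lvl j ≤ lvl i + r)) ∧
        (k + 1) * n < Module.finrank ℂ K) :
    ∃ C₀ n₀ : ℕ, ∀ n ≥ n₀, ∀ m : ℕ, C₀ * m ^ 2 < n ^ 3 → ∀ N : AffMat n m,
      IsAffine N → N ^ m = 0 →
      ∃ (K : Submodule ℂ (Fin n × Fin n → ℂ)) (k : ℕ),
        (∀ x v : Fin n × Fin n → ℂ, v ∈ K → ∀ i j : Fin m,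
          (((N.map (aeval fun c => (C (x c) + ∑ t : Fin 1, C (v c) * X t : MvPolynomial (Fin 1) ℂ))) ^ (n - 1)) i j).totalDegree
            ≤ k) ∧
        (k + 1) * n < Module.finrank ℂ K := by
  obtain ⟨C₀, n₀, h⟩ := hb
  exact ⟨C₀, n₀, fun n hn m hm N hN hnil => runBound n m N (h n hn m hm N hN hnil)⟩

end Summit.ValiantsHypothesis.ValiantsHypothesis.Theorems.GrenetZeon.FlagCost

end
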